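import Summits.QuantumFields.YangMills.Theorems.SoloBlindOddChessboard
import Summits.QuantumFields.YangMills.Theorems.SoloBlindMeanPlaquette
import HarnessLib

/-!
# SoloBlind: uniform exponential moments of the plaquette on odd tori (`YangMills`)

Solo seat `solo-QuantumFields-blind`, deliverable D12 (paper `local-gaussianity.md`, Lemma UI′),
part 3 of 3: the estimate itself.  The symmetry toolkit is `SoloBlindExpObservable`, the iterated
Schwarz inequality `SoloBlindOddChessboard`.

## Content

For a compact group `G`, a continuous representation `ρ : G →* M_N(ℂ)`, the Wilson action on the
discrete torus `Λ_L = (ℤ/Lℤ)^d` with `L ≥ 3` **odd**, `β ≥ 0`, `c ≥ 0` and ANY plaquette `p`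
(cost `φ_p = N - Re tr ρ(U_p) ∈ [0, 2N]`):

* `wilsonExpectation_exp_plaquetteCost_le`:
  `⟨exp(c φ_p)⟩_{Λ_L,β} ≤ exp( (4/L)^d (log Z_{Λ_L}(β - c) - log Z_{Λ_L}(β)) )`;
* `wilsonExpectation_sq_mul_plaquetteCost_le`:
  `⟨(β φ_p)²⟩_{Λ_L,β} ≤ 8 exp( (4/L)^d (log Z_{Λ_L}(β/2) - log Z_{Λ_L}(β)) )`;
* `weakCoupling_plaquetteCost_sq_of_freeEnergyDensity` (any compact `G`): if the torus free
  energy density satisfies `f(β) + c₀ log β → K` (`β → ∞`), then for all large `β`, then all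
  large `S`, every plaquette `p` of `Λ_{2S+1}` has
  `⟨(β φ_p)²⟩_{Λ_{2S+1},β} ≤ 8 exp( 4^d (c₀ log 2 + 1) )` — a bound UNIFORM as `β → ∞`, in the
  volume and in the position of the plaquette, on exactly the odd tori `2S+1` over which the
  summit's `SpeciesScheme` / `HasLatticeMassGap` data are defined;
* `weakCoupling_plaquetteCost_sq` (unitary models `G ≅ U(N)`, `d ≥ 2`, unconditionally, with
  `c₀ = (d-1)N²/2` from Chatterjee's theorem `tendsto_freeEnergyDensity_add_log`).

## Method (a chessboard estimate on the odd torus)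

The exponent `(4/L)^d (log Z(β-c) - log Z(β)) = 4^d (f_L(β-c) - f_L(β))` is a difference of
finite-volume free energy densities.  The proof consists of `k·d` iterated reflection-positivity
Schwarz inequalities, `2^k ≤ (L+1)/2 < 2^{k+1}`.  With the odd ("site") reflection `t ↦ 1 - t`
of `SoloBlindOddTorusRP` (`wilsonExpectation_odd_timeReflect_mul_ge`: positive for `β ≥ 0` on
bounded observables of the links of the half `1 ≤ t ≤ L/2`), a set `A` of plaquettes with base
times in `[0, n)`, `n ≤ L/2`, is translated by `e₀` into the positive half, doubled —
`⟨F_A⟩² = ⟨ΘF_A⟩⟨F_A⟩ ≤ ⟨ΘF_A · F_A⟩ = ⟨F_{ϑA ∪ A}⟩` for `F_A = exp(c ∑_{q∈A} φ_q)` — and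
translated back into `[0, 2n+1)` (`doubleStep`); `k` such steps fit into the torus
(`timeRound`); exchanging the axes `0 ↔ r` (`plaqSwap`, `wilsonExpectation_expObs_swap`, from
`SoloBlindSinglePlaquette`) runs the round in each of the `d` directions (`roundStep`,
`allRounds`), so `⟨exp(c φ_p)⟩^{2^{kd}} ≤ ⟨F_{A'}⟩` for some finite set `A'`.  The last
observable is bounded by monotonicity in the coupling: `φ_q ≥ 0` gives
`⟨exp(c ∑_{q∈A'} φ_q)⟩_β ≤ ⟨exp(c S)⟩_β = Z(β-c)/Z(β)` (`wilsonExpectation_expObs_le_exp`), and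
`L < 4·2^k` gives `L^d ≤ 4^d 2^{kd}`.  The second moment follows from `y² ≤ 2 e^y` (`y ≥ 0`),
and the weak-coupling corollaries from the existence of the free energy density
(`exists_hasFreeEnergyDensity_holds`) and `f(β) + c₀ log β → K`, whence
`f(β/2) - f(β) → c₀ log 2` — for `U(N)` Chatterjee's `c₀ = (d-1)N²/2`
(`tendsto_freeEnergyDensity_add_log`).

## Why this is on the path (and what it repairs)

The kernel reduction of IR-0 (`SoloBlindRatioInput`: `HasGaussianRatioBound → …`) is stated on
the odd tori `2S+1`.  Deriving `HasGaussianRatioBound` from the local Gaussianity theorem of the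
paper (Thm A: the connected plaquette two-point function at fixed separation is asymptotically
Gaussian as `β → ∞`; App. A) requires UNIFORM INTEGRABILITY of `(β φ_p)²` in the volume at fixed
large `β` (paper Lemma UI / Cor A′), which the paper proved by the chessboard estimate of
[FILS78, Thm 4.3] — valid on EVEN tori only (the reflections through sites pair the time slices).
This file proves the odd-torus version from the tree's odd reflection positivity: the
finite-volume inequality for every compact `G` and continuous `ρ`, the `β`-uniform bound for
every compact `G` GIVEN the free energy asymptotics `f(β) + c₀ log β → K` as a hypothesis, and
unconditionally for unitary models (`G ≅ U(N)`, where that asymptotics is in the tree).  For the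
summit's compact simple `G ⊆ U(N)` the hypothesis is the analogue of Chatterjee's theorem with
`c₀ = (d-1) dim G / 2` (Theorem C of the paper, not in the tree).  Nothing here touches the
infrared wall IR-1 (volume-uniform clustering at fixed `β`), which remains the obstruction
recorded in `SoloBlindInfraredFrontier` and `SoloBlindNoUniformRate`.

References: reflection positivity and chessboard estimates — [OS78] K. Osterwalder, E. Seiler,
Ann. Phys. 110 (1978) 440–471, §§2–3; [Se82] E. Seiler, LNP 159 (1982), Ch. 4; [FILS78]
J. Fröhlich, R. Israel, E. H. Lieb, B. Simon, Comm. Math. Phys. 62 (1978) 1–34, Thm 4.3; free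
energy asymptotics — [Ch16] S. Chatterjee, arXiv:1602.01222, Thm 2.1 (the tree's
`chatterjee_freeEnergy_holds`, via `SoloBlindMeanPlaquette`).  Everything proved here is an
elementary consequence ([folklore]) of the tree's reflection-positivity and convexity files.
-/

open MeasureTheory Filter Topology
open Literature.MathematicalPhysics.QuantumFieldTheory Literature.MathematicalPhysics.QuantumLattice

noncomputable section

namespace Summit.QuantumFields.YangMills.Theorems.SoloBlind

/-! ### The exponential-moment bound -/

section Main

variable {d L N : ℕ} {G : Type*} [Group G] [TopologicalSpace G]
  [IsTopologicalGroup G] [CompactSpace G] [MeasurableSpace G] [BorelSpace G]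
  (ρ : G →* Matrix (Fin N) (Fin N) ℂ)

/-- **Iterated reflection positivity (raw form).** `L ≥ 3` odd, `β ≥ 0`, `c ≥ 0`, continuous
`ρ`, `2^{k+1} ≤ L + 1`: for every plaquette `p`,
`⟨exp(c φ_p)⟩_{Λ_L,β}^{2^{kd}} ≤ Z_{Λ_L}(β - c)/Z_{Λ_L}(β)`. [folklore] -/
theorem wilsonExpectation_exp_pow_le [NeZero L] (hL : Odd L) (hL3 : 3 ≤ L) (hρ : Continuous ρ)
    {β c : ℝ} (hβ : 0 ≤ β) (hc : 0 ≤ c) {k : ℕ} (hk : 2 ^ (k + 1) ≤ L + 1) (p : Plaquette d L) :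
    wilsonExpectation ρ β (fun U : GaugeConfig d L G =>
        Real.exp (c * plaquetteCost ρ p.1 p.2.1.1 p.2.1.2 U)) ^ (2 ^ (k * d)) ≤
      Real.exp (torusLogPartition d ρ (β - c) L - torusLogPartition d ρ β L) := by
  rcases Nat.eq_zero_or_pos d with hd | hd
  · subst hd
    exact absurd p.2.1.1.isLt (by omega)
  haveI : NeZero d := ⟨by omega⟩
  set A₀ : Finset (Plaquette d L) := {((0 : Site d L), p.2)} with hA₀
  have hF : (fun U : GaugeConfig d L G => Real.exp (c * plaquetteCost ρ p.1 p.2.1.1 p.2.1.2 U)) =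
      expObs ρ c {p} := by
    funext U
    simp [expObs]
  have hT : plaqTranslate p.1 A₀ = {p} := by
    simp [plaqTranslate, hA₀]
  have h0 : (∀ q ∈ A₀, ∀ j : Fin d, 0 ≤ j.val → q.1 j = 0) := by
    intro q hq j _
    rw [hA₀, Finset.mem_singleton] at hq
    rw [hq]
    rfl
  obtain ⟨A', -, hle⟩ := allRounds ρ hL hL3 hρ hβ c hk d le_rfl h0
  rw [hF, ← hT, wilsonExpectation_expObs_plaqTranslate]
  have hρN : ∀ g : G, (ρ g).trace.re ≤ N := fun g => by
    have h := Literature.RepresentationTheory.CompactGroups.CompactGroup.abs_re_trace_le_card ρ hρ g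
    simp only [Fintype.card_fin] at h
    exact (le_abs_self _).trans h
  exact hle.trans (wilsonExpectation_expObs_le_exp ρ hρ hρN hc β A')

/-- `log Z_Λ(β - c) - log Z_Λ(β) ≥ 0` for `c ≥ 0` (the action is non-negative). [folklore] -/
theorem torusLogPartition_sub_nonneg [NeZero L] (hρ : Continuous ρ) {β c : ℝ} (hc : 0 ≤ c) :
    0 ≤ torusLogPartition d ρ (β - c) L - torusLogPartition d (G := G) ρ β L := by
  have h := mul_wilsonExpectation_wilsonAction_le (d := d) (L := L) (G := G) ρ hρ β (β - c)
  have hρN : ∀ g : G, (ρ g).trace.re ≤ N := fun g => by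
    have h := Literature.RepresentationTheory.CompactGroups.CompactGroup.abs_re_trace_le_card ρ hρ g
    simp only [Fintype.card_fin] at h
    exact (le_abs_self _).trans h
  have hS : 0 ≤ wilsonExpectation ρ β (wilsonAction (d := d) (L := L) (G := G) ρ) :=
    integral_nonneg fun U => wilsonAction_nonneg_of_re_trace_le ρ hρN U
  have : (β - (β - c)) * wilsonExpectation ρ β (wilsonAction (d := d) (L := L) (G := G) ρ) =
      c * wilsonExpectation ρ β (wilsonAction (d := d) (L := L) (G := G) ρ) := by ring
  rw [this] at h
  exact (mul_nonneg hc hS).trans h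

/-- **Uniform exponential moments of the plaquette on odd tori.** For `L ≥ 3` odd, `β ≥ 0`,
`c ≥ 0`, a continuous representation `ρ` of a compact group and every plaquette `p` of
`(ℤ/Lℤ)^d`:
`⟨exp(c φ_p)⟩_{Λ_L,β} ≤ exp( (4/L)^d · (log Z_{Λ_L}(β - c) - log Z_{Λ_L}(β)) )`,
`φ_p = N - Re tr ρ(U_p)`. The exponent is `4^d (f_L(β - c) - f_L(β))` with
`f_L = L^{-d} log Z_{Λ_L}` the finite-volume free energy density: a chessboard-type estimate
obtained from `k d` iterated reflection-positivity Schwarz inequalities (`2^k ≤ (L+1)/2 < 2^{k+1}`)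
in the `d` coordinate directions and monotonicity of the Boltzmann weight in the coupling.
[folklore] -/
theorem wilsonExpectation_exp_plaquetteCost_le [NeZero L] (hL : Odd L) (hL3 : 3 ≤ L)
    (hρ : Continuous ρ) {β c : ℝ} (hβ : 0 ≤ β) (hc : 0 ≤ c) (p : Plaquette d L) :
    wilsonExpectation ρ β (fun U : GaugeConfig d L G =>
        Real.exp (c * plaquetteCost ρ p.1 p.2.1.1 p.2.1.2 U)) ≤
      Real.exp ((4 : ℝ) ^ d / (L : ℝ) ^ d *
        (torusLogPartition d ρ (β - c) L - torusLogPartition d ρ β L)) := by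
  obtain ⟨m, hm⟩ := hL
  set k : ℕ := Nat.log 2 (L / 2 + 1) with hkdef
  have hk1 : 2 ^ k ≤ L / 2 + 1 := Nat.pow_log_le_self 2 (by omega)
  have hk2 : L / 2 + 1 < 2 ^ (k + 1) := Nat.lt_pow_succ_log_self (by norm_num) _
  have hk : 2 ^ (k + 1) ≤ L + 1 := by rw [pow_succ]; omega
  have hL4 : L < 4 * 2 ^ k := by rw [pow_succ] at hk2; omega
  set E : ℝ := torusLogPartition d ρ (β - c) L - torusLogPartition d (G := G) ρ β L with hE
  have hE0 : 0 ≤ E := torusLogPartition_sub_nonneg ρ hρ hc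
  set x : ℝ := wilsonExpectation ρ β (fun U : GaugeConfig d L G =>
    Real.exp (c * plaquetteCost ρ p.1 p.2.1.1 p.2.1.2 U)) with hx
  have hmain : x ^ (2 ^ (k * d)) ≤ Real.exp E :=
    wilsonExpectation_exp_pow_le ρ ⟨m, hm⟩ hL3 hρ hβ hc hk p
  set K : ℕ := 2 ^ (k * d) with hK
  have hK0 : (0 : ℝ) < K := by positivity
  -- `x ≤ exp (E / K)`
  have hxK : x ≤ Real.exp (E / K) := by
    by_contra h
    rw [not_le] at h
    have hlt : Real.exp (E / K) ^ K < x ^ K :=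
      pow_lt_pow_left₀ h (Real.exp_pos _).le (by positivity)
    rw [← Real.exp_nat_mul, mul_div_cancel₀ _ hK0.ne'] at hlt
    exact absurd (hlt.trans_le hmain) (lt_irrefl _)
  refine hxK.trans (Real.exp_le_exp.2 ?_)
  -- `E / K ≤ (4/L)^d E` since `L^d ≤ 4^d K`
  have hLK : (L : ℝ) ^ d ≤ (4 : ℝ) ^ d * K := by
    rw [hK]
    push_cast
    calc (L : ℝ) ^ d ≤ ((4 : ℝ) * 2 ^ k) ^ d := by
          gcongr
          exact_mod_cast hL4.le
      _ = (4 : ℝ) ^ d * 2 ^ (k * d) := by rw [mul_pow, ← pow_mul]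
  have hL0 : (0 : ℝ) < (L : ℝ) ^ d := by positivity
  have h1 : (1 : ℝ) / K ≤ (4 : ℝ) ^ d / (L : ℝ) ^ d := by
    rw [div_le_div_iff₀ hK0 hL0]
    linarith
  calc E / K = E * (1 / K) := by ring
    _ ≤ E * ((4 : ℝ) ^ d / (L : ℝ) ^ d) := mul_le_mul_of_nonneg_left h1 hE0
    _ = _ := by ring

/-- **Uniform second moments.** Under the same hypotheses and `c ≥ 0`:
`⟨(c φ_p)²⟩_{Λ_L,β} ≤ 2 exp( (4/L)^d (log Z_{Λ_L}(β - c) - log Z_{Λ_L}(β)) )`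
(`y² ≤ 2 e^y` for `y ≥ 0`). [folklore] -/
theorem wilsonExpectation_sq_plaquetteCost_le [NeZero L] (hL : Odd L) (hL3 : 3 ≤ L)
    (hρ : Continuous ρ) {β c : ℝ} (hβ : 0 ≤ β) (hc : 0 ≤ c) (p : Plaquette d L) :
    wilsonExpectation ρ β (fun U : GaugeConfig d L G =>
        (c * plaquetteCost ρ p.1 p.2.1.1 p.2.1.2 U) ^ 2) ≤
      2 * Real.exp ((4 : ℝ) ^ d / (L : ℝ) ^ d *
        (torusLogPartition d ρ (β - c) L - torusLogPartition d ρ β L)) := by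
  haveI := isProbabilityMeasure_wilsonMeasure (d := d) (L := L) (G := G) ρ hρ β
  have hρN : ∀ g : G, (ρ g).trace.re ≤ N := fun g => by
    have h := Literature.RepresentationTheory.CompactGroups.CompactGroup.abs_re_trace_le_card ρ hρ g
    simp only [Fintype.card_fin] at h
    exact (le_abs_self _).trans h
  have hpt : ∀ U : GaugeConfig d L G, (c * plaquetteCost ρ p.1 p.2.1.1 p.2.1.2 U) ^ 2 ≤
      2 * Real.exp (c * plaquetteCost ρ p.1 p.2.1.1 p.2.1.2 U) := by
    intro U
    have hy : 0 ≤ c * plaquetteCost ρ p.1 p.2.1.1 p.2.1.2 U :=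
      mul_nonneg hc (plaquetteCost_nonneg ρ hρN _ _ _ U)
    have h := Real.pow_div_factorial_le_exp _ hy 2
    rw [Nat.factorial_two, Nat.cast_ofNat, div_le_iff₀ (by norm_num : (0 : ℝ) < 2)] at h
    linarith
  obtain ⟨C, hC⟩ := exists_abs_expObs_le (d := d) (L := L) (G := G) ρ hρ c {p}
  have hint : Integrable (fun U : GaugeConfig d L G =>
      2 * Real.exp (c * plaquetteCost ρ p.1 p.2.1.1 p.2.1.2 U)) (wilsonMeasure ρ β) := by
    refine Integrable.of_bound (C := 2 * C) ?_ (ae_of_all _ fun U => ?_)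
    · exact ((measurable_expObs ρ hρ c {p}).const_mul 2).aestronglyMeasurable.congr
        (ae_of_all _ fun U => by simp [expObs])
    · have h := hC U
      simp only [expObs, Finset.sum_singleton] at h
      rw [Real.norm_eq_abs, abs_mul, abs_two]
      linarith
  calc wilsonExpectation ρ β (fun U : GaugeConfig d L G =>
          (c * plaquetteCost ρ p.1 p.2.1.1 p.2.1.2 U) ^ 2)
      ≤ wilsonExpectation ρ β (fun U : GaugeConfig d L G =>
          2 * Real.exp (c * plaquetteCost ρ p.1 p.2.1.1 p.2.1.2 U)) :=
        integral_mono_of_nonneg (ae_of_all _ fun U => sq_nonneg _) hint (ae_of_all _ hpt)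
    _ = 2 * wilsonExpectation ρ β (fun U : GaugeConfig d L G =>
          Real.exp (c * plaquetteCost ρ p.1 p.2.1.1 p.2.1.2 U)) := integral_const_mul _ _
    _ ≤ _ := by
        have := wilsonExpectation_exp_plaquetteCost_le ρ hL hL3 hρ hβ hc p
        linarith

/-- **Uniform second moments of the scaled plaquette `β φ_p` on odd tori** (`c = β/2`):
`⟨(β φ_p)²⟩_{Λ_L,β} ≤ 8 exp( (4/L)^d (log Z_{Λ_L}(β/2) - log Z_{Λ_L}(β)) )` for `L ≥ 3` odd,
`β ≥ 0`, every compact `G`, continuous `ρ`, every plaquette. [folklore] -/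
theorem wilsonExpectation_sq_mul_plaquetteCost_le [NeZero L] (hL : Odd L) (hL3 : 3 ≤ L)
    (hρ : Continuous ρ) {β : ℝ} (hβ : 0 ≤ β) (p : Plaquette d L) :
    wilsonExpectation ρ β (fun U : GaugeConfig d L G =>
        (β * plaquetteCost ρ p.1 p.2.1.1 p.2.1.2 U) ^ 2) ≤
      8 * Real.exp ((4 : ℝ) ^ d / (L : ℝ) ^ d *
        (torusLogPartition d ρ (β / 2) L - torusLogPartition d ρ β L)) := by
  have h := wilsonExpectation_sq_plaquetteCost_le ρ hL hL3 hρ hβ (c := β / 2) (by linarith) p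
  rw [show β - β / 2 = β / 2 by ring] at h
  have h4 : (fun U : GaugeConfig d L G => (β * plaquetteCost ρ p.1 p.2.1.1 p.2.1.2 U) ^ 2) =
      fun U => 4 * (β / 2 * plaquetteCost ρ p.1 p.2.1.1 p.2.1.2 U) ^ 2 := by
    funext U; ring
  rw [h4]
  unfold wilsonExpectation at h ⊢
  rw [integral_const_mul]
  linarith

end Main

/-! ### Weak coupling from free energy asymptotics -/

section WeakCoupling

variable {d N : ℕ} {G : Type} [Group G] [TopologicalSpace G] [IsTopologicalGroup G]
  [CompactSpace G] [MeasurableSpace G] [BorelSpace G]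

/-- **Uniform integrability of the scaled plaquette at weak coupling from free energy
asymptotics, on the odd tori of the summit (any compact `G`).**  If the torus free energy
density of the continuous model `ρ` satisfies `f(β) + c₀ log β → K` as `β → ∞` — the
Theorem-C-shaped input, `c₀ = (d-1) dim G / 2` for compact connected `G ⊆ U(N)`; a theorem in
the tree for `G ≅ U(N)` (`tendsto_freeEnergyDensity_add_log`, Chatterjee) — then for all
sufficiently large `β`, then all sufficiently large `S`, every plaquette `p` of `(ℤ/(2S+1)ℤ)^d`
satisfies `⟨(β φ_p)²⟩_{Λ_{2S+1}, β} ≤ 8 exp( 4^d (c₀ log 2 + 1) )`.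
Ingredients: `wilsonExpectation_sq_mul_plaquetteCost_le` (iterated reflection positivity on the
odd torus + monotonicity in the coupling) and the existence of the torus free energy density
(`exists_hasFreeEnergyDensity_holds`): `f(β/2) - f(β) → c₀ log 2`. [folklore] -/
theorem weakCoupling_plaquetteCost_sq_of_freeEnergyDensity [SecondCountableTopology G]
    (ρ : G →* Matrix (Fin N) (Fin N) ℂ) (hρc : Continuous ρ) {c₀ K : ℝ}
    (hg : Tendsto (fun β : ℝ => freeEnergyDensity d ρ β + c₀ * Real.log β) atTop (𝓝 K)) :
    ∀ᶠ β : ℝ in atTop, ∀ᶠ S : ℕ in atTop, ∀ p : Plaquette d (2 * S + 1),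
      wilsonExpectation ρ β (fun U : GaugeConfig d (2 * S + 1) G =>
          (β * plaquetteCost ρ p.1 p.2.1.1 p.2.1.2 U) ^ 2) ≤
        8 * Real.exp ((4 : ℝ) ^ d * (c₀ * Real.log 2 + 1)) := by
  -- `g(β/2) → K` as well
  have hg2 : Tendsto (fun β : ℝ => freeEnergyDensity d ρ (β / 2) + c₀ * Real.log (β / 2)) atTop
      (𝓝 K) := hg.comp (tendsto_id.atTop_div_const (by norm_num : (0 : ℝ) < 2))
  -- hence `f(β/2) - f(β) → c₀ log 2`
  have hdiff : Tendsto (fun β : ℝ => freeEnergyDensity d ρ (β / 2) - freeEnergyDensity d ρ β) atTop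
      (𝓝 (c₀ * Real.log 2)) := by
    have h1 : Tendsto (fun β : ℝ => (freeEnergyDensity d ρ (β / 2) + c₀ * Real.log (β / 2)) -
        (freeEnergyDensity d ρ β + c₀ * Real.log β) + c₀ * Real.log 2) atTop
        (𝓝 (K - K + c₀ * Real.log 2)) := (hg2.sub hg).add tendsto_const_nhds
    rw [sub_self, zero_add] at h1
    refine h1.congr' ?_
    filter_upwards [eventually_gt_atTop (0 : ℝ)] with β hβ
    rw [Real.log_div hβ.ne' (by norm_num)]
    ring
  have hev : ∀ᶠ β : ℝ in atTop, freeEnergyDensity d ρ (β / 2) - freeEnergyDensity d ρ β <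
      c₀ * Real.log 2 + 1 / 2 :=
    hdiff.eventually (gt_mem_nhds (by linarith))
  filter_upwards [hev, eventually_ge_atTop (0 : ℝ)] with β hβ hβ0
  -- finite-volume free energies at `β/2` and `β`
  have hf : ∀ b : ℝ,
      Tendsto (fun L : ℕ => (((L + 1 : ℕ) : ℝ) ^ d)⁻¹ * torusLogPartition d ρ b (L + 1))
        atTop (𝓝 (freeEnergyDensity d ρ b)) := fun b =>
    hasFreeEnergyDensity_freeEnergyDensity ρ (exists_hasFreeEnergyDensity_holds (d := d) ρ hρc b)
  have hfd : Tendsto (fun L : ℕ =>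
      (((L + 1 : ℕ) : ℝ) ^ d)⁻¹ * torusLogPartition d ρ (β / 2) (L + 1) -
        (((L + 1 : ℕ) : ℝ) ^ d)⁻¹ * torusLogPartition d ρ β (L + 1)) atTop
      (𝓝 (freeEnergyDensity d ρ (β / 2) - freeEnergyDensity d ρ β)) := (hf _).sub (hf _)
  have hevL : ∀ᶠ L : ℕ in atTop,
      (((L + 1 : ℕ) : ℝ) ^ d)⁻¹ * torusLogPartition d ρ (β / 2) (L + 1) -
        (((L + 1 : ℕ) : ℝ) ^ d)⁻¹ * torusLogPartition d ρ β (L + 1) < c₀ * Real.log 2 + 1 :=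
    hfd.eventually (gt_mem_nhds (by linarith))
  obtain ⟨L₀, hL₀⟩ := eventually_atTop.1 hevL
  refine eventually_atTop.2 ⟨L₀ + 1, fun S hS p => ?_⟩
  have hLS := hL₀ (2 * S) (by omega)
  have hodd : Odd (2 * S + 1) := ⟨S, rfl⟩
  have h3 : 3 ≤ 2 * S + 1 := by omega
  have hmain :=
    wilsonExpectation_sq_mul_plaquetteCost_le (d := d) (L := 2 * S + 1) ρ hodd h3 hρc hβ0 p
  refine hmain.trans ?_
  have h8 : (0 : ℝ) ≤ 8 := by norm_num
  refine mul_le_mul_of_nonneg_left (Real.exp_le_exp.2 ?_) h8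
  have heq : (4 : ℝ) ^ d / ((2 * S + 1 : ℕ) : ℝ) ^ d *
      (torusLogPartition d ρ (β / 2) (2 * S + 1) - torusLogPartition d ρ β (2 * S + 1)) =
      (4 : ℝ) ^ d * ((((2 * S + 1 : ℕ) : ℝ) ^ d)⁻¹ * torusLogPartition d ρ (β / 2) (2 * S + 1) -
        (((2 * S + 1 : ℕ) : ℝ) ^ d)⁻¹ * torusLogPartition d ρ β (2 * S + 1)) := by
    ring
  push_cast at heq ⊢
  rw [heq]
  refine mul_le_mul_of_nonneg_left ?_ (by positivity)
  have := hLS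
  push_cast at this
  linarith

/-- **Uniform integrability of the scaled plaquette at weak coupling, unitary models.** For
`d ≥ 2`, `N ≥ 1` and a unitary model `ρ : G →* M_N(ℂ)` (`G ≅ U(N)`): for all sufficiently
large `β`, then all sufficiently large `S`, every plaquette `p` of the torus `(ℤ/(2S+1)ℤ)^d`
satisfies `⟨(β φ_p)²⟩_{Λ_{2S+1}, β} ≤ 8 exp( 4^d ( ((d-1)N²/2) log 2 + 1 ) )` —
`weakCoupling_plaquetteCost_sq_of_freeEnergyDensity` with Chatterjee's leading term
(`tendsto_freeEnergyDensity_add_log`). [cite: arXiv160201222, Thm. 2.1] -/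
theorem weakCoupling_plaquetteCost_sq (ρ : G →* Matrix (Fin N) (Fin N) ℂ) (hd : 2 ≤ d)
    (hN : 1 ≤ N) (hρ : IsUnitaryModel ρ) :
    ∀ᶠ β : ℝ in atTop, ∀ᶠ S : ℕ in atTop, ∀ p : Plaquette d (2 * S + 1),
      wilsonExpectation ρ β (fun U : GaugeConfig d (2 * S + 1) G =>
          (β * plaquetteCost ρ p.1 p.2.1.1 p.2.1.2 U) ^ 2) ≤
        8 * Real.exp ((4 : ℝ) ^ d * (((d : ℝ) - 1) * (N : ℝ) ^ 2 / 2 * Real.log 2 + 1)) := by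
  have hρc : Continuous ρ := hρ.1
  haveI : SecondCountableTopology (Matrix (Fin N) (Fin N) ℂ) :=
    inferInstanceAs (SecondCountableTopology (Fin N → Fin N → ℂ))
  haveI : SecondCountableTopology G :=
    (hρc.isClosedEmbedding hρ.2.1).isEmbedding.secondCountableTopology
  obtain ⟨K, hK⟩ := tendsto_freeEnergyDensity_add_log ρ hd hN hρ
  have hg : Tendsto (fun β : ℝ => freeEnergyDensity d ρ β +
      ((d : ℝ) - 1) * (N : ℝ) ^ 2 / 2 * Real.log β) atTop (𝓝 K) := by
    refine hK.congr fun β => ?_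
    ring
  exact weakCoupling_plaquetteCost_sq_of_freeEnergyDensity ρ hρc hg

end WeakCoupling

end Summit.QuantumFields.YangMills.Theorems.SoloBlind
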